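import Summits.Ventures.Crystal3D.Theorems.StickyWulffConstantGenericWallFloorStepGain
import Summits.Ventures.Crystal3D.Theorems.StickyWulffConstantCoaxialWallLawTerracePropagation
import HarnessLib

/-!
# The sharp capper rise: the best of three cappers rises by `√(2/3)·n_z + √(1 − n_z²)/(2√3)`

HONEST FRAMING. Part of the venture `Summits/Ventures/Crystal3D` (cell `crystal3d-full`), helper
`--supports` the crux `GenericWallFloor` (stmt-Ventures-19480) of `route-Ventures-StickyWulffConstant`,
registered line `WallLedgerG`, open stub `stub_twoSlabAdhesion` (general fillings).  Brick of the STACK WALK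
(translate rule) ledger: a coherent walker that meets an exact twin cap steps to the best-rising capper; to
iterate this through arbitrarily many caps one needs a rise bound that PROPAGATES.  `…StepGain`'s
`exists_capper_rise` (19480-p1) uses only the mean `Σᵢ ⟪cᵢ, z⟫ = √6 ⟪n, z⟫` and needs a steep arrival; here
the second moment is added.

* `sum_sq_inner_cappers` — for three unit vectors `c₁, c₂, c₃` pairwise at inner product `½` with
  `⟪cᵢ, n⟫ = √(2/3)` (`n` unit) and any unit `z`: `Σᵢ ⟪cᵢ, z⟫² = (1 + 3 ⟪n, z⟫²)/2` (the `cᵢ` are a basis with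
  Gram matrix `½(I + J)`, whose inverse is `2I − J/2`).
* `capper_max_quadratic` — hence the largest `M = maxᵢ ⟪cᵢ, z⟫` satisfies
  `6M² − 4√6 s M + (9/2)s² − 1/2 ≥ 0` and `M ≥ √6 s/3` (`s = ⟪n, z⟫`), i.e. `M ≥ √(2/3) s + √(1 − s²)/(2√3)`.
* **`best_capper_bounds`** — numerically: if `s ≥ 1/7` then `M ≥ 3/8` AND `2√(2/3) M − s ≥ 1/7`.  The second
  clause is the `z`-component of the OTHER `{111}` normal `n* = 2√(2/3) c − n` through the chosen capper `c`,
  so the invariant «every cap normal met by the walk has `⟪n, z⟫ ≥ 1/7`» survives a cap-of-a-capper, and every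
  capper step rises by at least `3/8`.

WHAT THIS IS NOT: not the stub; pure slot geometry; F-C1 not moved.
-/

noncomputable section

namespace Summit.Ventures.Crystal3D.Theorems

open scoped InnerProductSpace

/-- Three unit vectors pairwise at inner product `½` are linearly independent. -/
theorem linearIndependent_of_unit_pairwise_half {c₁ c₂ c₃ : EuclideanSpace ℝ (Fin 3)}
    (h₁ : ‖c₁‖ = 1) (h₂ : ‖c₂‖ = 1) (h₃ : ‖c₃‖ = 1)
    (h₁₂ : ⟪c₁, c₂⟫_ℝ = 1 / 2) (h₁₃ : ⟪c₁, c₃⟫_ℝ = 1 / 2) (h₂₃ : ⟪c₂, c₃⟫_ℝ = 1 / 2) :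
    LinearIndependent ℝ ![c₁, c₂, c₃] := by
  have n0 : ⟪c₁, c₁⟫_ℝ = 1 := by rw [real_inner_self_eq_norm_sq, h₁, one_pow]
  have n1 : ⟪c₂, c₂⟫_ℝ = 1 := by rw [real_inner_self_eq_norm_sq, h₂, one_pow]
  have n2 : ⟪c₃, c₃⟫_ℝ = 1 := by rw [real_inner_self_eq_norm_sq, h₃, one_pow]
  have h10 : ⟪c₂, c₁⟫_ℝ = 1 / 2 := by rw [real_inner_comm]; exact h₁₂
  have h20 : ⟪c₃, c₁⟫_ℝ = 1 / 2 := by rw [real_inner_comm]; exact h₁₃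
  have h21 : ⟪c₃, c₂⟫_ℝ = 1 / 2 := by rw [real_inner_comm]; exact h₂₃
  rw [Fintype.linearIndependent_iff]
  intro g hg
  simp only [Fin.sum_univ_three, Matrix.cons_val_zero, Matrix.cons_val_one, Matrix.cons_val] at hg
  have e0 := congrArg (fun v => ⟪v, c₁⟫_ℝ) hg
  have e1 := congrArg (fun v => ⟪v, c₂⟫_ℝ) hg
  have e2 := congrArg (fun v => ⟪v, c₃⟫_ℝ) hg
  simp only [inner_add_left, real_inner_smul_left, inner_zero_left, n0, n1, n2, h₁₂, h₁₃, h₂₃, h10, h20,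
    h21] at e0 e1 e2
  intro i
  fin_cases i
  · show g 0 = 0; linarith
  · show g 1 = 0; linarith
  · show g 2 = 0; linarith

/-- **Second moment of the capper heights.**  See the module docstring. -/
theorem sum_sq_inner_cappers {c₁ c₂ c₃ n z : EuclideanSpace ℝ (Fin 3)}
    (h₁ : ‖c₁‖ = 1) (h₂ : ‖c₂‖ = 1) (h₃ : ‖c₃‖ = 1) (hn : ‖n‖ = 1) (hz : ‖z‖ = 1)
    (h₁₂ : ⟪c₁, c₂⟫_ℝ = 1 / 2) (h₁₃ : ⟪c₁, c₃⟫_ℝ = 1 / 2) (h₂₃ : ⟪c₂, c₃⟫_ℝ = 1 / 2)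
    (hn₁ : ⟪c₁, n⟫_ℝ = Real.sqrt (2 / 3)) (hn₂ : ⟪c₂, n⟫_ℝ = Real.sqrt (2 / 3))
    (hn₃ : ⟪c₃, n⟫_ℝ = Real.sqrt (2 / 3)) :
    ⟪c₁, z⟫_ℝ ^ 2 + ⟪c₂, z⟫_ℝ ^ 2 + ⟪c₃, z⟫_ℝ ^ 2 = (1 + 3 * ⟪n, z⟫_ℝ ^ 2) / 2 := by
  obtain ⟨a₁, ha₁⟩ : ∃ a : ℝ, a = ⟪c₁, z⟫_ℝ := ⟨_, rfl⟩
  obtain ⟨a₂, ha₂⟩ : ∃ a : ℝ, a = ⟪c₂, z⟫_ℝ := ⟨_, rfl⟩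
  obtain ⟨a₃, ha₃⟩ : ∃ a : ℝ, a = ⟪c₃, z⟫_ℝ := ⟨_, rfl⟩
  obtain ⟨S, hS⟩ : ∃ S : ℝ, S = a₁ + a₂ + a₃ := ⟨_, rfl⟩
  rw [← ha₁, ← ha₂, ← ha₃]
  -- the candidate expansion of `z` in the basis `cᵢ` (inverse Gram matrix `2I − J/2`)
  obtain ⟨q, hq⟩ : ∃ q : EuclideanSpace ℝ (Fin 3),
      q = (2 * a₁ - S / 2) • c₁ + (2 * a₂ - S / 2) • c₂ + (2 * a₃ - S / 2) • c₃ := ⟨_, rfl⟩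
  have n0 : ⟪c₁, c₁⟫_ℝ = 1 := by rw [real_inner_self_eq_norm_sq, h₁, one_pow]
  have n1 : ⟪c₂, c₂⟫_ℝ = 1 := by rw [real_inner_self_eq_norm_sq, h₂, one_pow]
  have n2 : ⟪c₃, c₃⟫_ℝ = 1 := by rw [real_inner_self_eq_norm_sq, h₃, one_pow]
  have h10 : ⟪c₂, c₁⟫_ℝ = 1 / 2 := by rw [real_inner_comm]; exact h₁₂
  have h20 : ⟪c₃, c₁⟫_ℝ = 1 / 2 := by rw [real_inner_comm]; exact h₁₃
  have h21 : ⟪c₃, c₂⟫_ℝ = 1 / 2 := by rw [real_inner_comm]; exact h₂₃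
  have hq1 : ⟪q, c₁⟫_ℝ = a₁ := by
    rw [hq]; simp only [inner_add_left, real_inner_smul_left, n0, h10, h20]; rw [hS]; ring
  have hq2 : ⟪q, c₂⟫_ℝ = a₂ := by
    rw [hq]; simp only [inner_add_left, real_inner_smul_left, n1, h₁₂, h21]; rw [hS]; ring
  have hq3 : ⟪q, c₃⟫_ℝ = a₃ := by
    rw [hq]; simp only [inner_add_left, real_inner_smul_left, n2, h₁₃, h₂₃]; rw [hS]; ring
  -- `q − z` is orthogonal to the basis, hence zero
  have hind := linearIndependent_of_unit_pairwise_half h₁ h₂ h₃ h₁₂ h₁₃ h₂₃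
  have hqz : q - z = 0 := by
    refine eq_zero_of_inner_eq_zero_of_indep hind ?_ ?_ ?_
    · rw [inner_sub_right, real_inner_comm, hq1, ha₁]; ring
    · rw [inner_sub_right, real_inner_comm, hq2, ha₂]; ring
    · rw [inner_sub_right, real_inner_comm, hq3, ha₃]; ring
  have hqz' : q = z := sub_eq_zero.1 hqz
  have hzz : ⟪z, z⟫_ℝ = 1 := by rw [real_inner_self_eq_norm_sq, hz, one_pow]
  have key : (2 * a₁ - S / 2) * a₁ + (2 * a₂ - S / 2) * a₂ + (2 * a₃ - S / 2) * a₃ = 1 := by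
    have hexp : ⟪q, z⟫_ℝ = (2 * a₁ - S / 2) * a₁ + (2 * a₂ - S / 2) * a₂ + (2 * a₃ - S / 2) * a₃ := by
      rw [hq]; simp only [inner_add_left, real_inner_smul_left]; rw [ha₁, ha₂, ha₃]
    rw [← hexp, hqz', hzz]
  -- the mean: `S = √6 ⟪n, z⟫`
  have hsum := sum_eq_sqrt_six_smul c₁ c₂ c₃ n h₁ h₂ h₃ hn h₁₂ h₁₃ h₂₃ hn₁ hn₂ hn₃
  have hSz : S = Real.sqrt 6 * ⟪n, z⟫_ℝ := by
    have := congrArg (fun v => ⟪v, z⟫_ℝ) hsum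
    simp only [inner_add_left, real_inner_smul_left] at this
    rw [hS, ha₁, ha₂, ha₃]; exact this
  have h6 : Real.sqrt 6 ^ 2 = 6 := Real.sq_sqrt (by norm_num)
  have hS2 : S ^ 2 = 6 * ⟪n, z⟫_ℝ ^ 2 := by rw [hSz, mul_pow, h6]
  have key' : 2 * (a₁ ^ 2 + a₂ ^ 2 + a₃ ^ 2) - S * (a₁ + a₂ + a₃) / 2 = 1 := by rw [← key]; ring
  rw [← hS] at key'
  nlinarith [key', hS2]

/-- Real-arithmetic core: three numbers `≤ M`, one of them `= M`, with sum `t`, have sum of squares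
`≤ 2M² + (t − 2M)²`. -/
theorem sum_sq_le_of_max (a₁ a₂ a₃ t M : ℝ) (h₁ : a₁ ≤ M) (h₂ : a₂ ≤ M) (h₃ : a₃ ≤ M)
    (hM : M = a₁ ∨ M = a₂ ∨ M = a₃) (ht : a₁ + a₂ + a₃ = t) :
    a₁ ^ 2 + a₂ ^ 2 + a₃ ^ 2 ≤ 2 * M ^ 2 + (t - 2 * M) ^ 2 := by
  subst ht
  rcases hM with rfl | rfl | rfl
  · nlinarith only [mul_nonneg (sub_nonneg.2 h₂) (sub_nonneg.2 h₃)]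
  · nlinarith only [mul_nonneg (sub_nonneg.2 h₁) (sub_nonneg.2 h₃)]
  · nlinarith only [mul_nonneg (sub_nonneg.2 h₁) (sub_nonneg.2 h₂)]

/-- **The quadratic constraint on the maximal capper height.**  With the data of `sum_sq_inner_cappers`,
a maximal `M = ⟪c, z⟫` (`c ∈ {c₁, c₂, c₃}`, `⟪cᵢ, z⟫ ≤ M`) satisfies `6M² − 4√6 s M + (9/2)s² − 1/2 ≥ 0`
and `√6 s ≤ 3M`, where `s = ⟪n, z⟫`. -/
theorem capper_max_quadratic {c₁ c₂ c₃ n z : EuclideanSpace ℝ (Fin 3)}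
    (h₁ : ‖c₁‖ = 1) (h₂ : ‖c₂‖ = 1) (h₃ : ‖c₃‖ = 1) (hn : ‖n‖ = 1) (hz : ‖z‖ = 1)
    (h₁₂ : ⟪c₁, c₂⟫_ℝ = 1 / 2) (h₁₃ : ⟪c₁, c₃⟫_ℝ = 1 / 2) (h₂₃ : ⟪c₂, c₃⟫_ℝ = 1 / 2)
    (hn₁ : ⟪c₁, n⟫_ℝ = Real.sqrt (2 / 3)) (hn₂ : ⟪c₂, n⟫_ℝ = Real.sqrt (2 / 3))
    (hn₃ : ⟪c₃, n⟫_ℝ = Real.sqrt (2 / 3)) {M : ℝ}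
    (hM₁ : ⟪c₁, z⟫_ℝ ≤ M) (hM₂ : ⟪c₂, z⟫_ℝ ≤ M) (hM₃ : ⟪c₃, z⟫_ℝ ≤ M)
    (hM : M = ⟪c₁, z⟫_ℝ ∨ M = ⟪c₂, z⟫_ℝ ∨ M = ⟪c₃, z⟫_ℝ) :
    0 ≤ 6 * M ^ 2 - 4 * Real.sqrt 6 * ⟪n, z⟫_ℝ * M + 9 / 2 * ⟪n, z⟫_ℝ ^ 2 - 1 / 2 ∧
      Real.sqrt 6 * ⟪n, z⟫_ℝ ≤ 3 * M := by
  have hsq := sum_sq_inner_cappers h₁ h₂ h₃ hn hz h₁₂ h₁₃ h₂₃ hn₁ hn₂ hn₃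
  have hsum := sum_eq_sqrt_six_smul c₁ c₂ c₃ n h₁ h₂ h₃ hn h₁₂ h₁₃ h₂₃ hn₁ hn₂ hn₃
  have hSz : ⟪c₁, z⟫_ℝ + ⟪c₂, z⟫_ℝ + ⟪c₃, z⟫_ℝ = Real.sqrt 6 * ⟪n, z⟫_ℝ := by
    have := congrArg (fun v => ⟪v, z⟫_ℝ) hsum
    simp only [inner_add_left, real_inner_smul_left] at this
    exact this
  refine ⟨?_, by linarith⟩
  have h6 : Real.sqrt 6 ^ 2 = 6 := Real.sq_sqrt (by norm_num)
  have key := sum_sq_le_of_max _ _ _ _ M hM₁ hM₂ hM₃ hM hSz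
  rw [hsq] at key
  nlinarith [key, h6]

/-- **Best-capper bounds (numerical form).**  If moreover `⟪n, z⟫ ≥ 1/7`, the maximal capper height is at
least `3/8`, and `2√(2/3) M − ⟪n, z⟫ ≥ 1/7` (the height of the second `{111}` normal through that capper). -/
theorem best_capper_bounds {c₁ c₂ c₃ n z : EuclideanSpace ℝ (Fin 3)}
    (h₁ : ‖c₁‖ = 1) (h₂ : ‖c₂‖ = 1) (h₃ : ‖c₃‖ = 1) (hn : ‖n‖ = 1) (hz : ‖z‖ = 1)
    (h₁₂ : ⟪c₁, c₂⟫_ℝ = 1 / 2) (h₁₃ : ⟪c₁, c₃⟫_ℝ = 1 / 2) (h₂₃ : ⟪c₂, c₃⟫_ℝ = 1 / 2)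
    (hn₁ : ⟪c₁, n⟫_ℝ = Real.sqrt (2 / 3)) (hn₂ : ⟪c₂, n⟫_ℝ = Real.sqrt (2 / 3))
    (hn₃ : ⟪c₃, n⟫_ℝ = Real.sqrt (2 / 3)) (hs : (1 / 7 : ℝ) ≤ ⟪n, z⟫_ℝ) {M : ℝ}
    (hM₁ : ⟪c₁, z⟫_ℝ ≤ M) (hM₂ : ⟪c₂, z⟫_ℝ ≤ M) (hM₃ : ⟪c₃, z⟫_ℝ ≤ M)
    (hM : M = ⟪c₁, z⟫_ℝ ∨ M = ⟪c₂, z⟫_ℝ ∨ M = ⟪c₃, z⟫_ℝ) :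
    (3 / 8 : ℝ) ≤ M ∧ (1 / 7 : ℝ) ≤ 2 * Real.sqrt (2 / 3) * M - ⟪n, z⟫_ℝ := by
  obtain ⟨hP, hmean⟩ := capper_max_quadratic h₁ h₂ h₃ hn hz h₁₂ h₁₃ h₂₃ hn₁ hn₂ hn₃ hM₁ hM₂ hM₃ hM
  obtain ⟨s, hs_def⟩ : ∃ s : ℝ, s = ⟪n, z⟫_ℝ := ⟨_, rfl⟩
  obtain ⟨r, hr_def⟩ : ∃ r : ℝ, r = Real.sqrt 6 := ⟨_, rfl⟩
  rw [← hs_def] at hP hmean hs ⊢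
  rw [← hr_def] at hP hmean
  -- `s ≤ 1` (Cauchy–Schwarz)
  have hs1 : s ≤ 1 := by
    have := real_inner_le_norm n z
    rw [hn, hz, one_mul] at this; rw [hs_def]; exact this
  have h6 : r ^ 2 = 6 := by rw [hr_def]; exact Real.sq_sqrt (by norm_num)
  have hr0 : 0 ≤ r := by rw [hr_def]; exact Real.sqrt_nonneg 6
  have hrlo : (2.449 : ℝ) < r := by
    rw [hr_def, show (2.449 : ℝ) = Real.sqrt (2.449 ^ 2) by rw [Real.sqrt_sq (by norm_num)]]
    exact Real.sqrt_lt_sqrt (by norm_num) (by norm_num)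
  have hrhi : r < 2.45 := by
    rw [hr_def, show (2.45 : ℝ) = Real.sqrt (2.45 ^ 2) by rw [Real.sqrt_sq (by norm_num)]]
    exact Real.sqrt_lt_sqrt (by norm_num) (by norm_num)
  -- `√(2/3) = r/3`
  have hd : Real.sqrt (2 / 3) = r / 3 := by
    rw [hr_def, show (2 / 3 : ℝ) = 6 / 9 by norm_num, Real.sqrt_div (by norm_num),
      show (9 : ℝ) = 3 ^ 2 by norm_num, Real.sqrt_sq (by norm_num)]
  have hs0 : 0 < s := by linarith
  have hrs0 : 0 < r * s := mul_pos (by linarith) hs0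
  have hlow : r * s / 3 ≤ M := by linarith
  -- (a) `M ≥ 3/8`
  have hMa : (3 / 8 : ℝ) ≤ M := by
    by_cases hbig : (1 / 2 : ℝ) ≤ s
    · -- `M ≥ r s / 3 ≥ r/6 > 3/8`
      nlinarith only [hlow, hrlo, hbig, hr0]
    · push Not at hbig
      by_contra hlt
      push Not at hlt
      -- chord of the convex quadratic on `[rs/3, 3/8]`: `L(M) := P(M) + 6 (M − rs/3)(3/8 − M) ≥ 0`
      have hprod : 0 ≤ (M - r * s / 3) * (3 / 8 - M) := mul_nonneg (by linarith) (by linarith)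
      have hL : 0 ≤ 9 / 4 * M - 2 * (r * s) * M - 3 / 4 * (r * s) + 9 / 2 * s ^ 2 - 1 / 2 := by
        have e : 9 / 4 * M - 2 * (r * s) * M - 3 / 4 * (r * s) + 9 / 2 * s ^ 2 - 1 / 2 =
            (6 * M ^ 2 - 4 * r * s * M + 9 / 2 * s ^ 2 - 1 / 2) + 6 * ((M - r * s / 3) * (3 / 8 - M)) := by
          ring
        rw [e]; exact add_nonneg hP (mul_nonneg (by norm_num) hprod)
      have hsq_s : 0 ≤ (s - 1 / 7) * (1 / 2 - s) := mul_nonneg (by linarith) (by linarith)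
      by_cases hslope : 2 * (r * s) ≤ 9 / 4
      · -- nondecreasing in `M`: the value at `M = 3/8` bounds it, and it is negative
        have hup : (9 / 4 - 2 * (r * s)) * M ≤ (9 / 4 - 2 * (r * s)) * (3 / 8) :=
          mul_le_mul_of_nonneg_left hlt.le (by linarith)
        nlinarith only [hL, hup, hsq_s, hrlo, hs, hbig, hrs0]
      · push Not at hslope
        -- decreasing in `M`: the value at `M = rs/3` bounds it, and equals `s²/2 − 1/2 < 0`
        have hup : (9 / 4 - 2 * (r * s)) * M ≤ (9 / 4 - 2 * (r * s)) * (r * s / 3) :=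
          mul_le_mul_of_nonpos_left hlow (by linarith)
        have hrs2 : (r * s) * (r * s) = 6 * s ^ 2 := by
          have : (r * s) * (r * s) = r ^ 2 * s ^ 2 := by ring
          rw [this, h6]
        have hup' : (9 / 4 - 2 * (r * s)) * M ≤ 3 / 4 * (r * s) - 4 * s ^ 2 := by
          have e : (9 / 4 - 2 * (r * s)) * (r * s / 3) = 3 / 4 * (r * s) - 2 / 3 * ((r * s) * (r * s)) := by
            ring
          rw [e, hrs2] at hup; linarith
        have hL' : 0 ≤ (9 / 4 - 2 * (r * s)) * M - 3 / 4 * (r * s) + 9 / 2 * s ^ 2 - 1 / 2 := by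
          have e : (9 / 4 - 2 * (r * s)) * M = 9 / 4 * M - 2 * (r * s) * M := by ring
          rw [e]; exact hL
        nlinarith only [hL', hup', hs1, hbig, hs0]
  refine ⟨hMa, ?_⟩
  -- (b) `2√(2/3) M − s ≥ 1/7`
  rw [hd]
  obtain ⟨N, hN⟩ : ∃ N : ℝ, N = 2 * (r / 3) * M - s := ⟨_, rfl⟩
  rw [← hN]
  have hNlo : s / 3 ≤ N := by
    have h' : 0 ≤ r * (3 * M - r * s) := mul_nonneg hr0 (by linarith)
    have e : r * (3 * M - r * s) = 3 * (r * M) - r ^ 2 * s := by ring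
    rw [e, h6] at h'
    rw [hN]; linarith
  by_cases hbig : (3 / 7 : ℝ) ≤ s
  · linarith
  · push Not at hbig
    by_contra hlt
    push Not at hlt
    -- the constraint in terms of `N`: `(9/4)N² − (3/2)sN + (3/4)s² − 1/2 ≥ 0`
    have e : 6 * M ^ 2 - 4 * r * s * M + 9 / 2 * s ^ 2 - 1 / 2 =
        9 / 4 * N ^ 2 - 3 / 2 * s * N + 3 / 4 * s ^ 2 - 1 / 2 := by
      rw [hN]; linear_combination (-(M ^ 2)) * h6
    rw [e] at hP
    have hN0 : 0 ≤ N := by linarith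
    nlinarith only [hP, hNlo, hlt, hbig, hs0, hN0, mul_nonneg hN0 hs0.le]

end Summit.Ventures.Crystal3D.Theorems

end
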